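import Summits.HubbardSuperconductivity.HubbardSuperconductivity.Theorems.AnisotropyChordStiffnessDoobLoops
import Summits.HubbardSuperconductivity.HubbardSuperconductivity.Theorems.AnisotropyChordStiffnessDoobDictionary

/-!
# Route `AnisotropyChord` / H0 rotor rung: GRADIENT STATES — no corrector when the amplitude is swap-invariant; the
# FERROMAGNETIC-POINT rung FM, network side (port of theory seat `hubbard-h0-rotor-theory-1`, cycle 10, `Sketch10.lean`
# Part M, memo ROTOR-THEORY-10 §145; work-order v10)

The Doob winding drive is a discrete GRADIENT (`orient_eq_sub`), so for a swap-invariant (sector-uniform) amplitude the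
weighted drive `c·s` is divergence-free and `g = 0` minimises the winding energy — NO CORRECTOR
(`Loop.energy_zero_le_of_divFree`, `windingEnergy_zero_le_of_swapInvariant`); `W_j(a; 0) = ¼ Σ_σ a(σ)² D_j(σ)` with the
domain-wall count `wallCount` (`windingEnergy_zero_eq`); hence `windingEnergy_ge_of_swapInvariant` and the sequence forms
**`doobWindingStiffness_of_swapInvariant`**, **`variationalTwistStiffness_of_swapInvariant`**.  The exchangeability count
that evaluates the wall density of a uniform sector state is the companion file `…StiffnessDoobExchangeability`; the link
to `H(1)` (Perron amplitude at `Δ = 1` is uniform on its sector) is `…StiffnessFerroPointStiffness`.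
Typing/proof authority: theory seat `hubbard-h0-rotor-theory-1`, cycle 10.
-/

set_option linter.dupNamespace false

noncomputable section

open Matrix Complex Finset Filter Topology
open scoped ComplexConjugate
open Literature.MathematicalPhysics.QuantumLattice hiding torusPhase torusNorm
open Literature.Probability.LatticeModels
open Summit.HubbardSuperconductivity.HubbardSuperconductivity.Theorems.AnisotropyChord.InsertionEntropy
  (torusPhase norm_torusPhase IsPerronSectorGroundAmplitude)
open Summit.HubbardSuperconductivity.HubbardSuperconductivity.Theorems.AnisotropyChord.Stiffness

/-! ## Part M — GRADIENT STATES: no corrector when the amplitude is swap-invariant; the FERROMAGNETIC-POINT rung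
(memo ROTOR-THEORY-10 §145).  For the uniform-on-sector Perron amplitudes of the isotropic ferromagnetic point
(`Δ = 1` in the tree's convention, `…FerroPointValue`) the winding drive of the Doob network is divergence-free
(the exclusion network is a GRADIENT system: `orient = ∇(occupation)`), so `g = 0` is the minimiser and the twist
stiffness is the `a²`-mean domain-wall density — exactly. -/

namespace Summit.HubbardSuperconductivity.HubbardSuperconductivity.Theorems.AnisotropyChord.Stiffness.Loop

variable {V E : Type*} [Fintype E] [Fintype V] [DecidableEq V] {src tgt : E → V}

/-- GRADIENT CONDITION (abstract network): if the conductance-weighted drive `c·s` has zero out- and in-divergence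
at every vertex, the zero potential minimises the energy — no corrector is needed. [folklore: gradient lattice gases] -/
theorem energy_zero_le_of_divFree {c s : E → ℝ} (hc : ∀ e, 0 ≤ c e)
    (hsrc : ∀ v, ∑ e ∈ univ.filter (fun e => src e = v), c e * s e = 0)
    (htgt : ∀ v, ∑ e ∈ univ.filter (fun e => tgt e = v), c e * s e = 0) (g : V → ℝ) :
    energy src tgt c s 0 ≤ energy src tgt c s g := by
  have h1 := sum_mul_apply_eq_fiber tgt (fun e => c e * s e) g
  have h2 := sum_mul_apply_eq_fiber src (fun e => c e * s e) g
  simp only [htgt, hsrc, mul_zero, sum_const_zero] at h1 h2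
  have hgrad : ∑ e, (c e * s e) * (g (tgt e) - g (src e)) = 0 := by
    simp only [mul_sub, sum_sub_distrib, h1, h2, sub_self]
  have key : energy src tgt c s g
      = energy src tgt c s 0 + (∑ e, c e * (g (tgt e) - g (src e)) ^ 2
          - 2 * ∑ e, (c e * s e) * (g (tgt e) - g (src e))) := by
    unfold energy
    rw [mul_sum, ← sum_sub_distrib, ← sum_add_distrib]
    exact sum_congr rfl fun e _ => by simp only [Pi.zero_apply]; ring
  rw [key, hgrad, mul_zero, sub_zero]
  exact le_add_of_nonneg_right (sum_nonneg fun e _ => mul_nonneg (hc e) (sq_nonneg _))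

end Summit.HubbardSuperconductivity.HubbardSuperconductivity.Theorems.AnisotropyChord.Stiffness.Loop

namespace Summit.HubbardSuperconductivity.HubbardSuperconductivity.Theorems.AnisotropyChord.Stiffness.Doob

variable {L : ℕ} [NeZero L]

/-- Every element of `Fin 2` is `0` or `1`. [folklore] -/
theorem fin2_eq_zero_or_one : ∀ v : Fin 2, v = 0 ∨ v = 1 := by decide

omit [NeZero L] in
/-- `orient` IS A DISCRETE GRADIENT of the occupation indicator — the gradient condition of the exclusion
network. [folklore] -/
theorem orient_eq_sub (x y : TorusSite 2 L) (σ : TensorIndex (TorusSite 2 L) 2) :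
    orient x y σ = (if σ y = 1 then (1 : ℝ) else 0) - (if σ x = 1 then (1 : ℝ) else 0) := by
  unfold orient
  rcases fin2_eq_zero_or_one (σ x) with hx | hx <;> rcases fin2_eq_zero_or_one (σ y) with hy | hy <;>
    simp [hx, hy]

/-- The total drive out of any configuration vanishes: `Σ_x orient(x, x+v; σ) = 0`. [folklore] -/
theorem sum_orient_add_eq_zero (v : TorusSite 2 L) (σ : TensorIndex (TorusSite 2 L) 2) :
    ∑ x, orient x (x + v) σ = 0 := by
  simp only [orient_eq_sub, sum_sub_distrib]
  rw [sub_eq_zero]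
  exact Fintype.sum_equiv (Equiv.addRight v) _ _ (fun x => rfl)

omit [NeZero L] in
/-- Flipping a bond reverses its orientation. [folklore] -/
theorem orient_comp_swap (x y : TorusSite 2 L) (σ : TensorIndex (TorusSite 2 L) 2) :
    orient x y (σ ∘ Equiv.swap x y) = -orient x y σ := by
  simp only [orient_eq_sub, Function.comp_apply, Equiv.swap_apply_left, Equiv.swap_apply_right]
  ring

omit [NeZero L] in
/-- On a flippable bond the orientation squares to `1`. [folklore] -/
theorem orient_sq_of_ne {x y : TorusSite 2 L} {σ : TensorIndex (TorusSite 2 L) 2} (h : σ x ≠ σ y) :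
    orient x y σ ^ 2 = 1 := by
  rw [orient_eq_sub]
  rcases fin2_eq_zero_or_one (σ x) with hx | hx <;> rcases fin2_eq_zero_or_one (σ y) with hy | hy <;>
    simp_all

/-- Amplitudes invariant under every transposition of two sites (= constant on each particle-number sector):
the Perron amplitudes of the isotropic ferromagnetic point (uniform on the sector, tree `…FerroPointValue`) and
RK states of exchangeable lattice gases. [folklore] -/
def SwapInvariant (a : TensorIndex (TorusSite 2 L) 2 → ℝ) : Prop :=
  ∀ (σ : TensorIndex (TorusSite 2 L) 2) (x y : TorusSite 2 L), a (σ ∘ Equiv.swap x y) = a σ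

omit [NeZero L] in
/-- For a swap-invariant amplitude the weighted drive `c·s` of a hop-edge is `¼ a(σ)² [i=j] orient`. [folklore] -/
theorem hopCond_mul_hopDrive_of_swapInvariant {a : TensorIndex (TorusSite 2 L) 2 → ℝ} (ha : SwapInvariant a)
    (j : Fin 2) (p : TorusSite 2 L × Fin 2) (σ : TensorIndex (TorusSite 2 L) 2) :
    hopCond a (p, σ) * hopDrive j (p, σ)
      = (1 / 4 : ℝ) * a σ ^ 2 * ((if p.2 = j then (1 : ℝ) else 0) * orient p.1 (p.1 + Pi.single p.2 1) σ) := by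
  unfold hopCond hopDrive hopTgt
  simp only
  by_cases h : σ p.1 ≠ σ (p.1 + Pi.single p.2 1)
  · rw [if_pos h, ha σ]; ring
  · rw [if_neg h]
    have h0 : orient p.1 (p.1 + Pi.single p.2 1) σ = 0 := by
      push Not at h
      rw [orient_eq_sub, h]; simp
    rw [h0]; ring

omit [NeZero L] in
/-- `τ ∘ swap x y = σ ↔ τ = σ ∘ swap x y`. [folklore] -/
theorem comp_swap_eq_iff (τ σ : TensorIndex (TorusSite 2 L) 2) (x y : TorusSite 2 L) :
    τ ∘ Equiv.swap x y = σ ↔ τ = σ ∘ Equiv.swap x y := by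
  constructor
  · rintro rfl; funext z; simp [Equiv.swap_apply_self]
  · rintro rfl; funext z; simp [Equiv.swap_apply_self]

/-- The hop-edges out of `σ` are `((x,i), σ)`. [folklore] -/
theorem sum_filter_hopSrc (F : HopEdge L → ℝ) (σ : TensorIndex (TorusSite 2 L) 2) :
    ∑ e ∈ univ.filter (fun e => hopSrc e = σ), F e = ∑ p : TorusSite 2 L × Fin 2, F (p, σ) := by
  rw [sum_filter, Fintype.sum_prod_type]
  refine sum_congr rfl fun p _ => ?_
  have hiff : ∀ τ : TensorIndex (TorusSite 2 L) 2, (hopSrc (p, τ) = σ) ↔ (τ = σ) := fun τ => Iff.rfl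
  simp only [hiff]
  simp [Finset.sum_ite_eq']

/-- The hop-edges into `σ` are `((x,i), σ ∘ swap)`. [folklore] -/
theorem sum_filter_hopTgt (F : HopEdge L → ℝ) (σ : TensorIndex (TorusSite 2 L) 2) :
    ∑ e ∈ univ.filter (fun e => hopTgt e = σ), F e
      = ∑ p : TorusSite 2 L × Fin 2, F (p, σ ∘ Equiv.swap p.1 (p.1 + Pi.single p.2 1)) := by
  rw [sum_filter, Fintype.sum_prod_type]
  refine sum_congr rfl fun p _ => ?_
  have hiff : ∀ τ : TensorIndex (TorusSite 2 L) 2,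
      (hopTgt (p, τ) = σ) ↔ (τ = σ ∘ Equiv.swap p.1 (p.1 + Pi.single p.2 1)) := by
    intro τ; simp only [hopTgt]; exact comp_swap_eq_iff τ σ _ _
  simp only [hiff]
  simp [Finset.sum_ite_eq']

/-- Out-divergence of the conductance-weighted winding drive vanishes for swap-invariant amplitudes. [folklore] -/
theorem srcSum_eq_zero_of_swapInvariant {a : TensorIndex (TorusSite 2 L) 2 → ℝ} (ha : SwapInvariant a)
    (j : Fin 2) (σ : TensorIndex (TorusSite 2 L) 2) :
    ∑ e ∈ univ.filter (fun e => hopSrc e = σ), hopCond a e * hopDrive j e = 0 := by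
  rw [sum_filter_hopSrc]
  simp only [hopCond_mul_hopDrive_of_swapInvariant ha]
  rw [Fintype.sum_prod_type]
  have hx : ∀ x : TorusSite 2 L,
      ∑ i : Fin 2, (1 / 4 : ℝ) * a σ ^ 2 * ((if i = j then (1 : ℝ) else 0) * orient x (x + Pi.single i 1) σ)
        = ((1 / 4 : ℝ) * a σ ^ 2) * orient x (x + Pi.single j 1) σ := by
    intro x
    rw [Fin.sum_univ_two]
    rcases fin2_eq_zero_or_one j with rfl | rfl <;> simp
  simp only [hx]
  rw [← mul_sum, sum_orient_add_eq_zero, mul_zero]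

/-- In-divergence likewise (flipping reverses the orientation). [folklore] -/
theorem tgtSum_eq_zero_of_swapInvariant {a : TensorIndex (TorusSite 2 L) 2 → ℝ} (ha : SwapInvariant a)
    (j : Fin 2) (σ : TensorIndex (TorusSite 2 L) 2) :
    ∑ e ∈ univ.filter (fun e => hopTgt e = σ), hopCond a e * hopDrive j e = 0 := by
  rw [sum_filter_hopTgt]
  have ha' : ∀ (τ : TensorIndex (TorusSite 2 L) 2) (x y : TorusSite 2 L), a (τ ∘ ⇑(Equiv.swap x y)) = a τ := ha
  simp only [hopCond_mul_hopDrive_of_swapInvariant ha, orient_comp_swap, ha']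
  rw [Fintype.sum_prod_type]
  have hx : ∀ x : TorusSite 2 L,
      ∑ i : Fin 2, (1 / 4 : ℝ) * a σ ^ 2 * ((if i = j then (1 : ℝ) else 0) * -orient x (x + Pi.single i 1) σ)
        = -((1 / 4 : ℝ) * a σ ^ 2) * orient x (x + Pi.single j 1) σ := by
    intro x
    rw [Fin.sum_univ_two]
    rcases fin2_eq_zero_or_one j with rfl | rfl <;> simp
  simp only [hx]
  rw [← mul_sum, sum_orient_add_eq_zero, mul_zero]

/-- **NO CORRECTOR for swap-invariant amplitudes**: `W_j(a; 0) ≤ W_j(a; g)` for every potential `g`.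
[new: theory seat hubbard-h0-rotor-theory-1, cycle 10, 2026-08-28] -/
theorem windingEnergy_zero_le_of_swapInvariant {a : TensorIndex (TorusSite 2 L) 2 → ℝ} (ha : SwapInvariant a)
    (ha0 : ∀ σ, 0 ≤ a σ) (j : Fin 2) (g : TensorIndex (TorusSite 2 L) 2 → ℝ) :
    windingEnergy a j 0 ≤ windingEnergy a j g := by
  rw [windingEnergy_eq_energy, windingEnergy_eq_energy]
  exact Loop.energy_zero_le_of_divFree (hopCond_nonneg ha0) (srcSum_eq_zero_of_swapInvariant ha j)
    (tgtSum_eq_zero_of_swapInvariant ha j) g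

/-- Domain-wall count of `σ` across the `j`-bonds: `D_j(σ) = #{x : σ(x) ≠ σ(x + e_j)}`. [folklore] -/
def wallCount (j : Fin 2) (σ : TensorIndex (TorusSite 2 L) 2) : ℝ :=
  ∑ x : TorusSite 2 L, if σ x ≠ σ (x + Pi.single j 1) then (1 : ℝ) else 0

/-- The per-bond winding energy at `g = 0` for a swap-invariant amplitude. [folklore] -/
theorem bondWinding_zero_of_swapInvariant {a : TensorIndex (TorusSite 2 L) 2 → ℝ} (ha : SwapInvariant a)
    (x y : TorusSite 2 L) (t : ℝ) :
    bondWinding a x y t 0 = (1 / 4 : ℝ) * ∑ σ, (if σ x ≠ σ y then a σ ^ 2 * t ^ 2 else 0) := by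
  unfold bondWinding
  congr 1
  refine sum_congr rfl fun σ _ => ?_
  by_cases h : σ x ≠ σ y
  · rw [if_pos h, if_pos h, ha, Pi.zero_apply, Pi.zero_apply]
    have h2 : orient x y σ ^ 2 = 1 := orient_sq_of_ne h
    calc a σ * a σ * (0 - 0 - t * orient x y σ) ^ 2 = a σ ^ 2 * t ^ 2 * orient x y σ ^ 2 := by ring
      _ = a σ ^ 2 * t ^ 2 := by rw [h2, mul_one]
  · rw [if_neg h, if_neg h]

/-- **The uncorrected winding energy is the mean domain-wall count**: `W_j(a; 0) = ¼ Σ_σ a(σ)² D_j(σ)`.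
[new: theory seat hubbard-h0-rotor-theory-1, cycle 10, 2026-08-28] -/
theorem windingEnergy_zero_eq {a : TensorIndex (TorusSite 2 L) 2 → ℝ} (ha : SwapInvariant a) (j : Fin 2) :
    windingEnergy a j 0 = (1 / 4 : ℝ) * ∑ σ, a σ ^ 2 * wallCount j σ := by
  unfold windingEnergy
  simp only [bondWinding_zero_of_swapInvariant ha]
  rw [← mul_sum]
  congr 1
  rw [Fintype.sum_prod_type]
  have hi : ∀ x : TorusSite 2 L,
      ∑ i : Fin 2, ∑ σ : TensorIndex (TorusSite 2 L) 2,
          (if σ x ≠ σ (x + Pi.single i 1) then a σ ^ 2 * (if i = j then (1 : ℝ) else 0) ^ 2 else 0)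
        = ∑ σ : TensorIndex (TorusSite 2 L) 2, (if σ x ≠ σ (x + Pi.single j 1) then a σ ^ 2 else 0) := by
    intro x
    rw [Finset.sum_comm]
    refine sum_congr rfl fun σ _ => ?_
    have hre : ∀ i : Fin 2,
        (if σ x ≠ σ (x + Pi.single i 1) then a σ ^ 2 * (if i = j then (1 : ℝ) else 0) ^ 2 else 0)
          = if i = j then (if σ x ≠ σ (x + Pi.single i 1) then a σ ^ 2 else 0) else 0 := by
      intro i; split_ifs <;> simp
    simp only [hre, Finset.sum_ite_eq', Finset.mem_univ, if_true]
  simp only [hi]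
  rw [Finset.sum_comm]
  refine sum_congr rfl fun σ _ => ?_
  unfold wallCount
  rw [mul_sum]
  refine sum_congr rfl fun x _ => ?_
  split_ifs <;> simp

/-- **RUNG FM (network side, fixed `L`).**  For a swap-invariant nonnegative amplitude, a floor on the
`a²`-mean domain-wall count IS a winding-conductance floor: `2Υ₀L² ≤ Σ_σ a² D_j ⇒ ½Υ₀L² ≤ W_j(a; g)` for
all `g` — and `g = 0` attains it, so the constant is exact. [new: theory seat hubbard-h0-rotor-theory-1,
cycle 10, 2026-08-28] -/
theorem windingEnergy_ge_of_swapInvariant {a : TensorIndex (TorusSite 2 L) 2 → ℝ} (ha : SwapInvariant a)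
    (ha0 : ∀ σ, 0 ≤ a σ) (j : Fin 2) {Υ₀ : ℝ}
    (hDW : 2 * Υ₀ * (L : ℝ) ^ 2 ≤ ∑ σ, a σ ^ 2 * wallCount j σ)
    (g : TensorIndex (TorusSite 2 L) 2 → ℝ) :
    Υ₀ * (L : ℝ) ^ 2 / 2 ≤ windingEnergy a j g := by
  have h := windingEnergy_zero_le_of_swapInvariant ha ha0 j g
  rw [windingEnergy_zero_eq ha] at h
  linarith

/-- **RUNG FM (sector-sequence form).**  If, eventually in `L`, the Perron amplitudes of `H(Δ)` in the sectors
`M L − 1` are swap-invariant with `a²`-mean domain-wall density `≥ 2Υ₀` per site (the ferromagnetic point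
`Δ = 1`: uniform amplitude, density `2ρ(1−ρ)·V/(V−1)` by exchangeability), then `DoobWindingStiffness Δ M`
— hence `VariationalTwistStiffness Δ M` — holds with constant `Υ₀`. [new: theory seat
hubbard-h0-rotor-theory-1, cycle 10, 2026-08-28] -/
theorem doobWindingStiffness_of_swapInvariant (Δ : ℝ) (M : ℕ → ℝ) {Υ₀ : ℝ} (hΥ : 0 < Υ₀)
    (h : ∀ᶠ L : ℕ in atTop, ∀ [NeZero L], ∀ a : TensorIndex (TorusSite 2 L) 2 → ℝ,
      IsPerronSectorGroundAmplitude L Δ (M L - 1) a →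
        SwapInvariant a ∧ ∀ j : Fin 2, 2 * Υ₀ * (L : ℝ) ^ 2 ≤ ∑ σ, a σ ^ 2 * wallCount j σ) :
    DoobWindingStiffness Δ M := by
  refine ⟨Υ₀, hΥ, ?_⟩
  filter_upwards [h] with L hL
  intro _ a ha j g
  exact windingEnergy_ge_of_swapInvariant (hL a ha).1 ha.nonneg j ((hL a ha).2 j) g

/-- **RUNG FM in the audited currency:** swap-invariant Perron amplitudes with wall density `≥ 2Υ₀` give `VariationalTwistStiffness Δ M`. [new: theory seat hubbard-h0-rotor-theory-1, cycle 10, 2026-08-28] -/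
theorem variationalTwistStiffness_of_swapInvariant (Δ : ℝ) (M : ℕ → ℝ) {Υ₀ : ℝ} (hΥ : 0 < Υ₀)
    (h : ∀ᶠ L : ℕ in atTop, ∀ [NeZero L], ∀ a : TensorIndex (TorusSite 2 L) 2 → ℝ,
      IsPerronSectorGroundAmplitude L Δ (M L - 1) a →
        SwapInvariant a ∧ ∀ j : Fin 2, 2 * Υ₀ * (L : ℝ) ^ 2 ≤ ∑ σ, a σ ^ 2 * wallCount j σ) :
    VariationalTwistStiffness Δ M :=
  (doobWindingStiffness_iff_variational Δ M).1 (doobWindingStiffness_of_swapInvariant Δ M hΥ h)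

end Summit.HubbardSuperconductivity.HubbardSuperconductivity.Theorems.AnisotropyChord.Stiffness.Doob

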